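import Summits.ValiantsHypothesis.ValiantsHypothesis.Theorems.LacunarySymmetroidMatrixDescartesDoorA26WallBubblingSignedClusters
import Summits.ValiantsHypothesis.ValiantsHypothesis.Theorems.LacunarySymmetroidMatrixDescartesDoorA26WallBubblingSecondOrder

/-!
# `DoorA26` line `wall_bubbling` — SIGNED CLUSTER DATA, part 2: the chain's cluster construction re-run keeping the chamber's signs

HONEST FRAMING.  Object-search cell `pub-symmetroid`; crux `Theses.LacunarySymmetroid.DoorA26` (stmt-ValiantsHypothesis-19979; OPEN,
typed, never asserted).  Line `Cruxes/DoorA26/Lines/wall_bubbling.lean` (val-idea-15), obligation (M) `Stmt.stub_mixedWalls` (slot W1).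
Part 1 (`…WallBubblingSignedClusters`) proved the SIGN LAW for a real twenty in a cone (`twenty_sign_law`: the 21 polar Gram entries alternate
along the chamber order `σ`, up to one global sign).  This part carries the signs through the bubbling chain (def-free):

* `exists_clusterLimit_signed` — W3's `exists_clusterLimit_realisable` (the chain's S3c construction, `…BubblingAssembly.clusterLimit_of_data`)
  re-run keeping ONE more field it proves and forgets: if every twenty of the sequence obeys the `σ`-alternation law then so does every
  normalised recentred stage vector `D.a c ν` (each `D.a c ν p` is the POSITIVE multiple `N⁻¹ · exp (pairExp δ p · s)` of the Gram entry):
  `∀ c ν t t', 0 < (−1)^(t+t') · D.a c ν (σ t) · D.a c ν (σ t')`, besides realisability at every stage;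
* `exists_clusterLimit_signed_of_mem_closure_cone` — every `δ₀ ∈ closure (TwentyLocus ∩ cone σ)` carries such SIGNED, stage-realisable
  cluster data (sequence in the cone → `twenty_sign_law` + `zeros_of_twenty` per stage → `blocks` → the construction);
* `mixedWall_hblock_of_blowup` — W3's `mixedWall_hblock` (`…SecondOrderMixedWall`) with the blow-up cluster as INPUT (any cluster datum `D`,
  cluster `c` with `H c ≠ 0`, realisable, `BlockSumsZero`), so that the mixed block anatomy `hblock` is available for the SIGNED data; proof
  body = W3's (`mixedWall_firstOrder_pattern` + normalisation by `B = H c (i,i)`).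

This is input (b) of W1's KILL(j) (`…WallBubblingMixedParity.mixedWall_parity_kill`: opposite signs `G^ν_jj·G^ν_ii < 0`,
`G^ν_jk·G^ν_jl ≤ 0` at every stage).  NOT here: the KILL in census currency (`…WallBubblingKillSide`), the collapse regime.  Nothing in
this file bears on (M)/(W)/(R) themselves, on `DoorA26`, on `MatrixDescartes` (18050) or on `VP ≠ VNP`; registers unchanged.

Cell `pub-symmetroid`, seat val-sym-door-p2 g12 (W1 #10a, part 2, of R2694 (B)), `--supports stmt-ValiantsHypothesis-19979 --as helper`.
[folklore] Bolzano–Weierstrass bookkeeping — the chain's construction (val-idea-15 g1 / val-port-4 g1; W3 val-sym-door-p4 g10 kept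
realisability) re-run verbatim with one extra field. [this work] the packaging.
-/

-- `Summit.ValiantsHypothesis.ValiantsHypothesis.…` repeats a component by the D-0017 layout
-- (single-conjunct summit), which the `dupNamespace` linter flags; the name is mandated.
set_option linter.dupNamespace false

namespace Summit.ValiantsHypothesis.ValiantsHypothesis.Theorems.LacunarySymmetroidMatrixDescartes.WallBubbling.SecondOrder

open Finset Filter Topology
open scoped BigOperators
open Summit.ValiantsHypothesis.ValiantsHypothesis.Theorems.LacunarySymmetroidMatrixDescartes.WallBubbling.Bubbling

/-! ## Cluster limits with realisability AND the chamber's signs at every stage -/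

/-- Positive rescalings preserve the alternation inequality. [folklore] -/
theorem alt_pos_of_pos_factors {ε x y c d : ℝ} (h : 0 < ε * (x * y)) (hc : 0 < c) (hd : 0 < d) :
    0 < ε * ((c * x) * (d * y)) := by
  have : ε * ((c * x) * (d * y)) = (c * d) * (ε * (x * y)) := by ring
  rw [this]
  exact mul_pos (mul_pos hc hd) h

/-- **Cluster limits with realisability and SIGNS at every stage** (the chain's S3c construction = W3's `exists_clusterLimit_realisable`,
re-run keeping one more field it proves and forgets).  From twenties' data converging to `δ⋆` whose polar Gram vectors all obey the
alternation law of one pair order `σ` (`0 < (−1)^(t+t') · G^ν(σ t) · G^ν(σ t')`), one extracts `D : ClusterLimit δ⋆` such that every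
normalised recentred Gram vector `D.a c ν` is, as a `6 × 6` matrix, `Realisable`, AND obeys the same alternation law — each `D.a c ν p` is
the positive multiple `N⁻¹ · exp (pairExp δ p · s)` of the Gram entry `G^ν p`. [this work] -/
theorem exists_clusterLimit_signed (σ : Fin 21 → Fin 6 × Fin 6) (δstar : Fin 6 → ℝ) (δseq : ℕ → Fin 6 → ℝ)
    (hδ : ∀ l, Tendsto (fun ν => δseq ν l) atTop (𝓝 (δstar l)))
    (S : ℕ → Fin 6 → Matrix (Fin 2) (Fin 2) ℝ) (hS : ∀ ν l, (S ν l).IsSymm)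
    (hG0 : ∀ ν, (fun p : Pair => polar (S ν p.1) (S ν p.2)) ≠ 0)
    (hsgn : ∀ ν (t t' : Fin 21), 0 < (-1 : ℝ) ^ ((t : ℕ) + t') *
      (polar (S ν (σ t).1) (S ν (σ t).2) * polar (S ν (σ t').1) (S ν (σ t').2)))
    (z : ℕ → Fin 20 → ℝ) (hz : ∀ ν, StrictMono (z ν))
    (hzero : ∀ ν j, expSum (fun p : Pair => polar (S ν p.1) (S ν p.2)) (pairExp (δseq ν)) (z ν j) = 0)
    (C : ℕ) (start : Fin C → Fin 20) (blk : Fin 20 → Fin C) (R : ℝ)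
    (hwin : ∀ ν j, z ν j - z ν (start (blk j)) ∈ Set.Icc (-R) R)
    (hdrift : ∀ c c', c < c' → Tendsto (fun ν => z ν (start c') - z ν (start c)) atTop atTop) :
    ∃ D : ClusterLimit δstar, (∀ c ν, Realisable (Matrix.of fun k l => D.a c ν (k, l))) ∧
      ∀ c ν (t t' : Fin 21), 0 < (-1 : ℝ) ^ ((t : ℕ) + t') * (D.a c ν (σ t) * D.a c ν (σ t')) := by
  classical
  -- Gram vectors, centres, recentred vectors, norms, normalised vectors (verbatim from the chain)
  let G : ℕ → Pair → ℝ := fun ν p => polar (S ν p.1) (S ν p.2)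
  let s : Fin C → ℕ → ℝ := fun c ν => z ν (start c)
  let b : Fin C → ℕ → Pair → ℝ := fun c ν p => G ν p * Real.exp (pairExp (δseq ν) p * s c ν)
  have hb0 : ∀ c ν, b c ν ≠ 0 := by
    intro c ν hb
    apply hG0 ν
    funext p
    have := congrFun hb p
    simp only [b, Pi.zero_apply, mul_eq_zero, Real.exp_ne_zero, or_false] at this
    simpa [G] using this
  let N : Fin C → ℕ → ℝ := fun c ν => ‖b c ν‖
  have hNpos : ∀ c ν, 0 < N c ν := fun c ν => norm_pos_iff.mpr (hb0 c ν)
  let a : Fin C → ℕ → Pair → ℝ := fun c ν p => (N c ν)⁻¹ * (G ν p * Real.exp (pairExp (δseq ν) p * s c ν))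
  have ha_eq : ∀ c ν, a c ν = (N c ν)⁻¹ • b c ν := by
    intro c ν; funext p; simp only [a, b, Pi.smul_apply, smul_eq_mul]
  have hnorm_a : ∀ c ν, ‖a c ν‖ = 1 := by
    intro c ν
    rw [ha_eq, norm_smul, norm_inv, Real.norm_of_nonneg (norm_nonneg _)]
    exact inv_mul_cancel₀ (hNpos c ν).ne'
  have hbound : ∀ c ν p, |a c ν p| ≤ 1 := by
    intro c ν p
    have := norm_le_pi_norm (a c ν) p
    rw [Real.norm_eq_abs, hnorm_a] at this
    exact this
  have hreal_a : ∀ c ν, Realisable (Matrix.of fun k l => a c ν (k, l)) := fun c ν =>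
    realisable_recentred (δseq ν) (S ν) (hS ν) (N c ν)⁻¹ (s c ν)
  -- the ONE extra field: every stage vector inherits the alternation law of the Gram vector
  have hsgn_a : ∀ c ν (t t' : Fin 21), 0 < (-1 : ℝ) ^ ((t : ℕ) + t') * (a c ν (σ t) * a c ν (σ t')) := by
    intro c ν t t'
    have e1 : a c ν (σ t) = ((N c ν)⁻¹ * Real.exp (pairExp (δseq ν) (σ t) * s c ν)) * G ν (σ t) := by
      simp only [a]; ring
    have e2 : a c ν (σ t') = ((N c ν)⁻¹ * Real.exp (pairExp (δseq ν) (σ t') * s c ν)) * G ν (σ t') := by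
      simp only [a]; ring
    rw [e1, e2]
    exact alt_pos_of_pos_factors (hsgn ν t t') (mul_pos (inv_pos.mpr (hNpos c ν)) (Real.exp_pos _))
      (mul_pos (inv_pos.mpr (hNpos c ν)) (Real.exp_pos _))
  -- Bolzano–Weierstrass in `Fin C → Pair → ℝ`
  let A : ℕ → (Fin C → Pair → ℝ) := fun ν c => a c ν
  have hAball : ∀ ν, A ν ∈ Metric.closedBall (0 : Fin C → Pair → ℝ) 1 := by
    intro ν
    rw [Metric.mem_closedBall, dist_zero_right]
    refine (pi_norm_le_iff_of_nonneg zero_le_one).mpr fun c => ?_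
    exact (hnorm_a c ν).le
  obtain ⟨Hfull, -, ψ, hψ, hlim⟩ := tendsto_subseq_of_bounded Metric.isBounded_closedBall hAball
  have hlim_c : ∀ c, Tendsto (fun ν => a c (ψ ν)) atTop (𝓝 (Hfull c)) := fun c =>
    (tendsto_pi_nhds.mp hlim) c
  have hlim_cp : ∀ c p, Tendsto (fun ν => a c (ψ ν) p) atTop (𝓝 (Hfull c p)) := fun c p =>
    (tendsto_pi_nhds.mp (hlim_c c)) p
  have hHne : ∀ c, Hfull c ≠ 0 := by
    intro c
    have h1 : Tendsto (fun ν => ‖a c (ψ ν)‖) atTop (𝓝 ‖Hfull c‖) := (hlim_c c).norm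
    have h2 : Tendsto (fun ν => ‖a c (ψ ν)‖) atTop (𝓝 1) := by
      simp only [hnorm_a]; exact tendsto_const_nhds
    have : ‖Hfull c‖ = 1 := tendsto_nhds_unique h1 h2
    intro h0
    rw [h0, norm_zero] at this
    exact zero_ne_one this
  -- the structure, with realisability and signs of every stage as the extra outputs
  refine ⟨{
    C := C
    m := fun c => (Finset.univ.filter fun j : Fin 20 => blk j = c).card
    hm := ?_
    δseq := fun ν => δseq (ψ ν)
    hδ := fun l => (hδ l).comp hψ.tendsto_atTop
    a := fun c ν => a c (ψ ν)
    H := Hfull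
    ha := hlim_cp
    hbound := fun c ν p => hbound c (ψ ν) p
    hH := hHne
    hreal := ?_
    R := fun _ => R
    hzeros := ?_
    L := fun c c' ν => s c' (ψ ν) - s c (ψ ν)
    ρ := fun c c' ν => N c (ψ ν) / N c' (ψ ν)
    hρ := fun c c' ν => div_pos (hNpos c _) (hNpos c' _)
    hL := fun c c' hcc' => (hdrift c c' hcc').comp hψ.tendsto_atTop
    htransfer := ?_ }, fun c ν => hreal_a c (ψ ν), fun c ν t t' => hsgn_a c (ψ ν) t t'⟩
  · -- ∑ m c = 20
    have := Finset.card_eq_sum_card_fiberwise (f := blk) (s := (Finset.univ : Finset (Fin 20)))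
      (t := (Finset.univ : Finset (Fin C))) (fun _ _ => Finset.mem_univ _)
    rw [Finset.card_univ, Fintype.card_fin] at this
    exact this.symm
  · -- realisability of the limits (B11)
    intro c
    refine realisable_of_tendsto (Gseq := fun ν => Matrix.of fun k l => a c (ψ ν) (k, l)) ?_ ?_
    · intro ν
      exact hreal_a c (ψ ν)
    · exact tendsto_pi_nhds.mpr fun k => tendsto_pi_nhds.mpr fun l => hlim_cp c (k, l)
  · -- the zeros of cluster `c` in the window
    intro c ν
    refine ⟨(Finset.univ.filter fun j : Fin 20 => blk j = c).image fun j => z (ψ ν) j - s c (ψ ν), ?_, ?_⟩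
    · rw [Finset.card_image_of_injective]
      intro j j' h
      exact (hz (ψ ν)).injective (sub_left_injective h)
    · intro w hw
      obtain ⟨j, hj, rfl⟩ := Finset.mem_image.mp hw
      have hjc : blk j = c := (Finset.mem_filter.mp hj).2
      refine ⟨?_, ?_⟩
      · have := hwin (ψ ν) j
        rw [hjc] at this
        exact this
      · show expSum (a c (ψ ν)) (pairExp (δseq (ψ ν))) (z (ψ ν) j - s c (ψ ν)) = 0
        rw [show a c (ψ ν) = fun p => (N c (ψ ν))⁻¹ * (G (ψ ν) p * Real.exp (pairExp (δseq (ψ ν)) p * s c (ψ ν)))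
          from rfl, expSum_recenter, sub_add_cancel, hzero, mul_zero]
  · -- the transfer identity between clusters
    intro c c' _ ν p
    show a c' (ψ ν) p = a c (ψ ν) p * Real.exp (pairExp (δseq (ψ ν)) p * (s c' (ψ ν) - s c (ψ ν)))
      * (N c (ψ ν) / N c' (ψ ν))
    simp only [a]
    have hN := (hNpos c (ψ ν)).ne'
    have hN' := (hNpos c' (ψ ν)).ne'
    rw [mul_sub, Real.exp_sub]
    field_simp

/-- **SIGNED CLUSTER DATA FROM ONE CONE.**  Let `σ` list every pair up to swap.  Every `δ⋆` in the closure of the part of the twenty-locus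
lying in the open cone of `σ` carries cluster-limit data whose every stage matrix is realisable AND obeys the alternation law of `σ`:
`0 < (−1)^(t+t') · D.a c ν (σ t) · D.a c ν (σ t')` for all clusters `c`, stages `ν`, positions `t, t'` — i.e. the stage Gram entries carry the
chamber's Descartes signs (up to one global sign per stage). [this work] -/
theorem exists_clusterLimit_signed_of_mem_closure_cone (σ : Fin 21 → Fin 6 × Fin 6)
    (hcov : ∀ p : Fin 6 × Fin 6, ∃ t : Fin 21, σ t = p ∨ σ t = p.swap) (δstar : Fin 6 → ℝ)
    (hclos : δstar ∈ closure (TwentyLocus ∩ {δ : Fin 6 → ℝ | StrictMono ((fun p : Fin 6 × Fin 6 => δ p.1 + δ p.2) ∘ σ)})) :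
    ∃ D : ClusterLimit δstar, (∀ c ν, Realisable (Matrix.of fun k l => D.a c ν (k, l))) ∧
      ∀ c ν (t t' : Fin 21), 0 < (-1 : ℝ) ^ ((t : ℕ) + t') * (D.a c ν (σ t) * D.a c ν (σ t')) := by
  obtain ⟨δseq₀, hmem, hlim₀⟩ := mem_closure_iff_seq_limit.mp hclos
  have hT : ∀ ν, ∃ S : Fin 6 → Matrix (Fin 2) (Fin 2) ℝ, (∀ l, (S l).IsSymm) ∧
      20 ≤ {x : ℝ | 0 < x ∧ (∑ l, (x ^ (δseq₀ ν l)) • S l).det = 0}.ncard := fun ν => (hmem ν).1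
  choose S hS h20 using hT
  have hcone : ∀ ν, StrictMono ((fun p : Fin 6 × Fin 6 => δseq₀ ν p.1 + δseq₀ ν p.2) ∘ σ) := fun ν => (hmem ν).2
  have hsgn : ∀ ν (t t' : Fin 21), 0 < (-1 : ℝ) ^ ((t : ℕ) + t') *
      (polar (S ν (σ t).1) (S ν (σ t).2) * polar (S ν (σ t').1) (S ν (σ t').2)) :=
    fun ν t t' => twenty_sign_law σ hcov (δseq₀ ν) (hcone ν) (S ν) (hS ν) (h20 ν) t t'
  have hG0 : ∀ ν, (fun p : Pair => polar (S ν p.1) (S ν p.2)) ≠ 0 := fun ν => (zeros_of_twenty (δseq₀ ν) (S ν) (h20 ν)).1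
  have hzex : ∀ ν, ∃ z : Fin 20 → ℝ, StrictMono z ∧
      ∀ j, expSum (fun p : Pair => polar (S ν p.1) (S ν p.2)) (pairExp (δseq₀ ν)) (z j) = 0 :=
    fun ν => (zeros_of_twenty (δseq₀ ν) (S ν) (h20 ν)).2
  choose z hz hzero using hzex
  obtain ⟨φ, hφ, C, start, blk, R, -, -, hwin, hdrift⟩ := blocks z hz
  have hδ : ∀ l, Tendsto (fun ν => δseq₀ (φ ν) l) atTop (𝓝 (δstar l)) := fun l =>
    ((tendsto_pi_nhds.mp hlim₀) l).comp hφ.tendsto_atTop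
  exact exists_clusterLimit_signed σ δstar (fun ν => δseq₀ (φ ν)) hδ (fun ν => S (φ ν)) (fun ν => hS (φ ν))
    (fun ν => hG0 (φ ν)) (fun ν => hsgn (φ ν)) (fun ν => z (φ ν)) (fun ν => hz (φ ν)) (fun ν => hzero (φ ν))
    C start blk R (fun ν j => hwin ν j) hdrift

/-! ## The mixed-wall block anatomy of a GIVEN blow-up cluster (W3's part 3 with the cluster as input) -/

/-- **Mixed-wall `hblock` for a given blow-up cluster** (W3's `mixedWall_hblock` with the cluster as input).  At `δ⋆` on a generic mixed
wall (`2 δ⋆ᵢ = δ⋆ₖ + δ⋆ₗ` the only pair-sum coincidence), if a cluster `c` of a cluster datum `D` has a non-zero, realisable limit matrix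
`of (H c)` with `BlockSumsZero δ⋆`, then with `B := H c (i,i) ≠ 0` the stage matrices restricted to `I = (i,k,l)` and divided by `B`
converge to the pattern `P = Eᵢᵢ − ½(Eₖₗ + Eₗₖ)`, and every limit entry outside `{(i,i),(k,l),(l,k)}` vanishes. [this work] -/
theorem mixedWall_hblock_of_blowup (δstar : Fin 6 → ℝ)
    (i k l : Fin 6) (hik : i ≠ k) (hil : i ≠ l) (hkl : k ≠ l) (hwall : 2 * δstar i = δstar k + δstar l)
    (honly : ∀ a b a' b' : Fin 6, δstar a + δstar b = δstar a' + δstar b' →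
      ((a = a' ∧ b = b') ∨ (a = b' ∧ b = a')) ∨
      (((a = i ∧ b = i) ∨ (a = k ∧ b = l) ∨ (a = l ∧ b = k)) ∧
       ((a' = i ∧ b' = i) ∨ (a' = k ∧ b' = l) ∨ (a' = l ∧ b' = k))))
    (D : ClusterLimit δstar) (c : Fin D.C)
    (hne : (Matrix.of fun x y => D.H c (x, y)) ≠ 0) (hrealH : Realisable (Matrix.of fun x y => D.H c (x, y)))
    (hBSZ : BlockSumsZero δstar (Matrix.of fun x y => D.H c (x, y))) :
    ∃ B : ℝ, B ≠ 0 ∧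
      (∀ x y : Fin 6, ¬ ((x = i ∧ y = i) ∨ (x = k ∧ y = l) ∨ (x = l ∧ y = k)) → D.H c (x, y) = 0) ∧
      Tendsto (fun ν => B⁻¹ • (Matrix.of fun x y => D.a c ν (x, y)).submatrix ![i, k, l] ![i, k, l]) atTop
        (𝓝 !![1, 0, 0; 0, 0, -1/2; 0, -1/2, 0]) := by
  have hsym : (Matrix.of fun x y => D.H c (x, y)).IsSymm := isSymm_of_realisable hrealH
  obtain ⟨hzero, hkl', hlk'⟩ :=
    mixedWall_firstOrder_pattern δstar i k l hik hil hkl hwall honly _ hsym hBSZ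
  simp only [Matrix.of_apply] at hzero hkl' hlk'
  set B : ℝ := D.H c (i, i) with hBdef
  have hB : B ≠ 0 := by
    intro hB0
    apply hne
    ext x y
    rw [Matrix.of_apply, Matrix.zero_apply]
    by_cases hs : (x = i ∧ y = i) ∨ (x = k ∧ y = l) ∨ (x = l ∧ y = k)
    · rcases hs with ⟨rfl, rfl⟩ | ⟨rfl, rfl⟩ | ⟨rfl, rfl⟩
      · exact hB0
      · rw [hkl', hB0]; norm_num
      · rw [hlk', hB0]; norm_num
    · exact hzero x y hs
  refine ⟨B, hB, hzero, ?_⟩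
  have hik' : k ≠ i := fun h => hik h.symm
  have hil' : l ≠ i := fun h => hil h.symm
  have hkl'' : l ≠ k := fun h => hkl h.symm
  have key : ∀ x y : Fin 3, B⁻¹ * D.H c ((![i, k, l] : Fin 3 → Fin 6) x, (![i, k, l] : Fin 3 → Fin 6) y)
      = (!![1, 0, 0; 0, 0, -1/2; 0, -1/2, 0] : Matrix (Fin 3) (Fin 3) ℝ) x y := by
    intro x y
    fin_cases x <;> fin_cases y <;>
      simp only [Matrix.cons_val_zero, Matrix.cons_val_one, Matrix.cons_val_two, Matrix.head_cons, Matrix.tail_cons,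
        Fin.zero_eta, Fin.mk_one, Fin.reduceFinMk, Matrix.of_apply, Matrix.cons_val', Matrix.empty_val',
        Matrix.cons_val_fin_one, Matrix.head_fin_const]
    · rw [← hBdef]; exact inv_mul_cancel₀ hB
    · rw [hzero i k (by rintro (⟨-, h⟩ | ⟨h, -⟩ | ⟨h, -⟩) <;> [exact hik' h; exact hik h; exact hil h]), mul_zero]
    · rw [hzero i l (by rintro (⟨-, h⟩ | ⟨h, -⟩ | ⟨h, -⟩) <;> [exact hil' h; exact hik h; exact hil h]), mul_zero]
    · rw [hzero k i (by rintro (⟨h, -⟩ | ⟨-, h⟩ | ⟨h, -⟩) <;> [exact hik' h; exact hil' (h ▸ rfl) |>.elim; exact hkl (h ▸ rfl) |>.elim]), mul_zero]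
    · rw [hzero k k (by rintro (⟨h, -⟩ | ⟨-, h⟩ | ⟨h, -⟩) <;> [exact hik' h; exact hkl h; exact hkl h]), mul_zero]
    · rw [hkl']; field_simp
    · rw [hzero l i (by rintro (⟨h, -⟩ | ⟨h, -⟩ | ⟨-, h⟩) <;> [exact hil' h; exact hkl'' h; exact hik h]), mul_zero]
    · rw [hlk']; field_simp
    · rw [hzero l l (by rintro (⟨h, -⟩ | ⟨h, -⟩ | ⟨-, h⟩) <;> [exact hil' h; exact hkl'' h; exact hkl h.symm |>.elim]), mul_zero]
  refine tendsto_pi_nhds.mpr fun x => tendsto_pi_nhds.mpr fun y => ?_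
  have h1 := (D.ha c ((![i, k, l] : Fin 3 → Fin 6) x, (![i, k, l] : Fin 3 → Fin 6) y)).const_mul B⁻¹
  rw [key x y] at h1
  simpa only [Matrix.smul_apply, Matrix.submatrix_apply, Matrix.of_apply, smul_eq_mul] using h1

end Summit.ValiantsHypothesis.ValiantsHypothesis.Theorems.LacunarySymmetroidMatrixDescartes.WallBubbling.SecondOrder
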